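import Summits.SmoothPoincare4.SmoothPoincare4.Theorems.DottedCircleRasmussenDcrGapHelperFriendsCarrierTkAux11
import Summits.SmoothPoincare4.SmoothPoincare4.Theorems.DottedCircleRasmussenDcrGapHelperFriendsCarrierTkAux2
import Summits.SmoothPoincare4.SmoothPoincare4.Theorems.DottedCircleRasmussenDcrGapHelperFriendsCarrierTkAux7

/-!
# Helper `helper_friendsCarrier_Tk_endSmoothCollar` of stub `helper_friendsCarrier_Tk` — the end collar, part 5: the collar is smooth
(item stmt-SmoothPoincare4-16128, route route-SmoothPoincare4-DottedCircleRasmussen)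

Continuation of `…TkAux8–11` (end collar, parts 1–4), porting the section *Smoothness of the collar*
of the tree's `OpenTraceCollar.lean`:

* `EndDatum.SmoothPresentation Y` — a presentation of `Y` (`…TkAux8`) together with the smoothness
  clauses of the hypothesis block of `helper_friendsCarrier_Tk` (`jB` a smooth open embedding, `jM`
  smooth on the open `W ⊇ M_k ∖ K₀` with open image and smooth inverse `ψ` there);
* the open cover `tubeSet ∪ radSet ∪ flatSetY` of `Y × ℝ` on whose pieces the collar is
  `incl ∘ fTube ∘ (ι₀ ∘ ψ × id)`, `incl ∘ fRad ∘ (ψ × id)`, `inr ∘ fF ∘ (invB × id)`;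
* `EndDatum.SmoothPresentation.contMDiff_collar` — **the collar `Y × ℝ → T` is `C^∞`**;
* `helper_friendsCarrier_Tk_endSmoothCollar` — the registered summary.

Everything is proved; no named facts, no `sorry`.
References: Kirby (1989), Ch. I §5 [Kirby1989]; the tree's `OpenTraceCollar.lean`.
-/

-- the prescribed namespace `Summit.<P>.<Sub>.…` duplicates `SmoothPoincare4` (P = Sub)
set_option linter.dupNamespace false
set_option linter.style.longLine false

noncomputable section

open scoped Manifold ContDiff Topology
open Function Set Metric
open Literature.Topology.FourManifolds Literature.Topology.FourManifolds.MMSW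

namespace Summit.SmoothPoincare4.SmoothPoincare4.Theorems.DcrGap.MkFriends

namespace FriendsTk

namespace EndDatum

variable {k : ℕ} (E : EndDatum k)

/-- The values of the radial formula lie in `P` (`a ∈ M_k`). [folklore] -/
theorem fRad_mem_hbNbhd {a : EuclideanSpace ℝ (Fin 4)} (ha : a ∈ modelBoundary k) (σ : ℝ) : E.fRad (a, σ) ∈ E.hbNbhd :=
  E.θ_mem_hbNbhd_of_mem ha (E.collarTime_mem_Ioo (TraceCollar.αof_pos (Real.exp_pos _)))

/-- The values of the tube formula off the knot lie in `P`. [folklore] -/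
theorem fTube_mem_hbNbhd {q : ((Metric.sphere (0 : EuclideanSpace ℝ (Fin 2)) 1) × EuclideanSpace ℝ (Fin 2)) × ℝ} (hq : q.1.2 ≠ 0) :
    E.fTube q ∈ E.hbNbhd := by
  have hX : 0 < (TraceCollar.Φinv (Real.exp (-q.2), ‖q.1.2‖)).1 :=
    TraceCollar.Φinv_mem (TubeNbhd.mem_Quad_of_ne_zero q.2 hq)
  exact E.θ_ν₀_mem_hbNbhd _ (E.collarTime_mem_Ioo (TraceCollar.αof_pos hX))

/-- The tube part of `Y`: points of `M_k ∖ K₀` in the open tube `ν₀(𝕊¹ × ℝ²)`. [folklore] -/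
def tubeSet {Y : Type*} (jM : EuclideanSpace ℝ (Fin 4) → Y) : Set Y :=
  jM '' {a | a ∈ modelBoundary k ∧ a ∉ range E.K₀ ∧ a ∈ range E.ν₀}

/-- `tubeSet ⊆ mSet`. [folklore] -/
theorem tubeSet_subset_mSet {Y : Type*} (jM : EuclideanSpace ℝ (Fin 4) → Y) : E.tubeSet jM ⊆ E.mSet jM := by
  rintro _ ⟨a, ⟨ha, ha', -⟩, rfl⟩; exact ⟨a, ⟨ha, ha'⟩, rfl⟩

/-- A point of `M_k` lies in the flowed-out tube of `ν₀` iff it lies in the open tube `ν₀(𝕊¹ × ℝ²)`. [folklore] -/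
theorem mem_flowTube₀_iff_of_mem {a : EuclideanSpace ℝ (Fin 4)} (ha : a ∈ modelBoundary k) :
    a ∈ {y : EuclideanSpace ℝ (Fin 4) | (∀ j, (1 : ℝ) / 2 < holeTerm k j y) ∧ levelFun k y ∈ Ioo (1 - E.δ) (1 + E.δ) ∧
      E.θ (1 - levelFun k y, y) ∈ range E.ν₀} ↔ a ∈ range E.ν₀ := by
  have hg : ∀ j, (1 : ℝ) / 2 < holeTerm k j a := fun j => lt_of_lt_of_le (by norm_num) (ha.1 j)
  have h1 : E.θ (1 - levelFun k a, a) = a := by rw [ha.2, sub_self, E.θ_zero]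
  constructor
  · rintro ⟨-, -, h⟩; rwa [h1] at h
  · intro h
    exact ⟨hg, by rw [ha.2]; exact ⟨by linarith [E.δ_pos], by linarith [E.δ_pos]⟩, by rwa [h1]⟩

/-- **A smooth presentation of `Y` as `M_k` surgered along `K₀` via `ν₀`**: a presentation (`…TkAux8`)
whose solid torus `jB` is a smooth open embedding and whose `jM` is smooth on an open `W ⊇ M_k ∖ K₀` with
open image and smooth inverse `ψ` — the full hypothesis block of `helper_friendsCarrier_Tk`, bundled.
[folklore] -/
structure SmoothPresentation (Y : Type*) [TopologicalSpace Y] [ChartedSpace (EuclideanSpace ℝ (Fin 3)) Y]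
    extends E.Presentation Y where
  jB_emb : Manifold.IsSmoothEmbedding (𝓘(ℝ, EuclideanSpace ℝ (Fin 2)).prod (𝓡 1)) (𝓡 3) ∞ jB
  isOpen_range_jB : IsOpen (range jB)
  isOpen_W : IsOpen W
  mem_W : ∀ x ∈ modelBoundary k, x ∉ range E.K₀ → x ∈ W
  contMDiffOn_jM : ContMDiffOn 𝓘(ℝ, EuclideanSpace ℝ (Fin 4)) (𝓡 3) ∞ jM W
  isOpen_mSet' : IsOpen (jM '' {x : EuclideanSpace ℝ (Fin 4) | x ∈ modelBoundary k ∧ x ∉ range E.K₀})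
  contMDiffOn_ψ : ContMDiffOn (𝓡 3) 𝓘(ℝ, EuclideanSpace ℝ (Fin 4)) ∞ ψ
    (jM '' {x : EuclideanSpace ℝ (Fin 4) | x ∈ modelBoundary k ∧ x ∉ range E.K₀})

/-! ### Assembling the end datum and the smooth presentation from the hypotheses of `helper_friendsCarrier_Tk` -/

/-- **The end datum of a tube of a model knot**: the collar flow of piece (1) (`…TkAux1`), the tube
coordinates of piece (2) (`…TkAux2`) for the fibre-shrunken tube (`…TkAux7`) and for the tube itself,
assembled (by choice) into an `EndDatum`. [folklore] -/
def endDatumOf {K₀ : (Metric.sphere (0 : EuclideanSpace ℝ (Fin 2)) 1) → EuclideanSpace ℝ (Fin 4)}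
    {νK : (Metric.sphere (0 : EuclideanSpace ℝ (Fin 2)) 1) × EuclideanSpace ℝ (Fin 2) → EuclideanSpace ℝ (Fin 4)}
    (hν : ContMDiff ((𝓡 1).prod 𝓘(ℝ, EuclideanSpace ℝ (Fin 2))) 𝓘(ℝ, EuclideanSpace ℝ (Fin 4)) ∞ νK) (hinj : Injective νK)
    (himm : ∀ p, Injective (mfderiv ((𝓡 1).prod 𝓘(ℝ, EuclideanSpace ℝ (Fin 2))) 𝓘(ℝ, EuclideanSpace ℝ (Fin 4)) νK p))
    (hmem : ∀ p, νK p ∈ modelBoundary k) (hK : ∀ u, νK (u, 0) = K₀ u) : EndDatum k :=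
  let θ := (helper_friendsCarrier_Tk_collarFlow k).choose
  let δ := (helper_friendsCarrier_Tk_collarFlow k).choose_spec.choose
  let H := (helper_friendsCarrier_Tk_collarFlow k).choose_spec.choose_spec
  let hclock : ∀ y : EuclideanSpace ℝ (Fin 4), (∀ j, (1 : ℝ) / 2 < holeTerm k j y) → levelFun k y ∈ Ioo (1 - δ) (1 + δ) →
      ∀ t : ℝ, levelFun k y + t ∈ Ioo (1 - δ) (1 + δ) →
        (∀ j, (1 : ℝ) / 2 < holeTerm k j (θ (t, y))) ∧ levelFun k (θ (t, y)) = levelFun k y + t :=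
    fun y hg hG t ht => (H.2.2.2.2.2.1 y hg hG).1 t ht
  let hiff : ∀ a ∈ modelBoundary k, ∀ s ∈ Ioo (-δ) δ, (θ (s, a) ∈ modelHandlebody k ↔ s ≤ 0) :=
    fun a ha s hs => (H.2.2.2.2.2.2 a ha s hs).1
  let S := shrinkTube_aux hν hinj himm hmem hK
  let T := helper_friendsCarrier_Tk_tubeChart k
    (fun q : (Metric.sphere (0 : EuclideanSpace ℝ (Fin 2)) 1) × EuclideanSpace ℝ (Fin 2) =>
      νK (q.1, OpenPartialHomeomorph.univBall (0 : EuclideanSpace ℝ (Fin 2)) 2 q.2))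
    θ δ H.1 H.2.2.1 H.2.2.2.1 H.2.2.2.2.1 hclock S.1 S.2.1 S.2.2.1 S.2.2.2.1
  let T₀ := helper_friendsCarrier_Tk_tubeChart k νK θ δ H.1 H.2.2.1 H.2.2.2.1 H.2.2.2.2.1 hclock hν hinj himm hmem
  { νK := fun q => νK (q.1, OpenPartialHomeomorph.univBall (0 : EuclideanSpace ℝ (Fin 2)) 2 q.2), θ := θ, δ := δ, ι := T.2.choose,
    δ_pos := H.1, δ_lt_one := H.2.1, contDiff_θ := H.2.2.1, θ_zero := H.2.2.2.1, θ_add := H.2.2.2.2.1, clock := hclock,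
    mem_modelHandlebody_iff := hiff, contMDiff_νK := S.1, νK_mem := S.2.2.2.1, isOpen_flowTube' := T.1,
    contMDiffOn_ι := T.2.choose_spec.1, ι_θ := T.2.choose_spec.2.1, θ_ι := T.2.choose_spec.2.2,
    ν₀ := νK, K₀ := K₀, ι₀ := T₀.2.choose, νK_eq := fun _ => rfl, contMDiff_ν₀ := hν, injective_ν₀ := hinj, ν₀_mem := hmem,
    ν₀_zero := hK, isOpen_flowTube₀ := T₀.1, contMDiffOn_ι₀ := T₀.2.choose_spec.1, ι₀_θ := T₀.2.choose_spec.2.1 }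

section EndDatumOf

variable {K₀ : (Metric.sphere (0 : EuclideanSpace ℝ (Fin 2)) 1) → EuclideanSpace ℝ (Fin 4)}
  {νK : (Metric.sphere (0 : EuclideanSpace ℝ (Fin 2)) 1) × EuclideanSpace ℝ (Fin 2) → EuclideanSpace ℝ (Fin 4)}
  (hν : ContMDiff ((𝓡 1).prod 𝓘(ℝ, EuclideanSpace ℝ (Fin 2))) 𝓘(ℝ, EuclideanSpace ℝ (Fin 4)) ∞ νK) (hinj : Injective νK)
  (himm : ∀ p, Injective (mfderiv ((𝓡 1).prod 𝓘(ℝ, EuclideanSpace ℝ (Fin 2))) 𝓘(ℝ, EuclideanSpace ℝ (Fin 4)) νK p))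
  (hmem : ∀ p, νK p ∈ modelBoundary k) (hK : ∀ u, νK (u, 0) = K₀ u)

/-- The tube of the assembled end datum is the given one. [folklore] -/
theorem endDatumOf_ν₀ : (endDatumOf hν hinj himm hmem hK).ν₀ = νK := rfl

/-- The knot of the assembled end datum is the given one. [folklore] -/
theorem endDatumOf_K₀ : (endDatumOf hν hinj himm hmem hK).K₀ = K₀ := rfl

/-- The trace tube of the assembled end datum is the fibre-shrunken tube. [folklore] -/
theorem endDatumOf_νK (q : (Metric.sphere (0 : EuclideanSpace ℝ (Fin 2)) 1) × EuclideanSpace ℝ (Fin 2)) :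
    (endDatumOf hν hinj himm hmem hK).νK q = νK (q.1, OpenPartialHomeomorph.univBall (0 : EuclideanSpace ℝ (Fin 2)) 2 q.2) := rfl

/-- **The smooth presentation of `Y`** assembled from the hypothesis block of `helper_friendsCarrier_Tk`. [folklore] -/
def smoothPresentationOf {Y : Type*} [TopologicalSpace Y] [ChartedSpace (EuclideanSpace ℝ (Fin 3)) Y]
    {jB : ↥solidTorus → Y} {jM : EuclideanSpace ℝ (Fin 4) → Y} {W : Set (EuclideanSpace ℝ (Fin 4))} {ψ : Y → EuclideanSpace ℝ (Fin 4)}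
    (h1 : Manifold.IsSmoothEmbedding (𝓘(ℝ, EuclideanSpace ℝ (Fin 2)).prod (𝓡 1)) (𝓡 3) ∞ jB) (h2 : IsOpen (range jB)) (h8 : IsOpen W)
    (h9 : ∀ x ∈ modelBoundary k, x ∉ range K₀ → x ∈ W)
    (h10 : ContMDiffOn 𝓘(ℝ, EuclideanSpace ℝ (Fin 4)) (𝓡 3) ∞ jM W)
    (h11 : IsOpen (jM '' {x : EuclideanSpace ℝ (Fin 4) | x ∈ modelBoundary k ∧ x ∉ range K₀}))
    (h12 : ContMDiffOn (𝓡 3) 𝓘(ℝ, EuclideanSpace ℝ (Fin 4)) ∞ ψ (jM '' {x : EuclideanSpace ℝ (Fin 4) | x ∈ modelBoundary k ∧ x ∉ range K₀}))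
    (h13 : ∀ x ∈ modelBoundary k, x ∉ range K₀ → ψ (jM x) = x)
    (h14 : jM '' {x : EuclideanSpace ℝ (Fin 4) | x ∈ modelBoundary k ∧ x ∉ range K₀} ∪ range jB = univ)
    (h15 : ∀ x ∈ modelBoundary k, x ∉ range K₀ → ∀ b : ↥solidTorus, jM x = jB b ↔
      ∃ (u : Metric.sphere (0 : EuclideanSpace ℝ (Fin 2)) 1) (t : ℝ), t ∈ Ioo (0 : ℝ) 1 ∧
        b.1.1 = t • (u : EuclideanSpace ℝ (Fin 2)) ∧ x = νK (u, t • (b.1.2 : EuclideanSpace ℝ (Fin 2)))) :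
    (endDatumOf hν hinj himm hmem hK).SmoothPresentation Y :=
  { jM := jM, jB := jB, W := W, ψ := ψ, injective_jB := h1.isEmbedding.injective, ψ_jM := h13, cover := h14, rel := h15,
    jB_emb := h1, isOpen_range_jB := h2, isOpen_W := h8, mem_W := h9, contMDiffOn_jM := h10, isOpen_mSet' := h11, contMDiffOn_ψ := h12 }

end EndDatumOf

namespace SmoothPresentation

variable {E} {Y : Type*} [TopologicalSpace Y] [ChartedSpace (EuclideanSpace ℝ (Fin 3)) Y] (P : E.SmoothPresentation Y)

/-- The `M_k`-part of `Y` is open. [folklore] -/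
theorem isOpen_mSet : IsOpen (E.mSet P.jM) := P.isOpen_mSet'

/-- **Images under `jM` of relatively open subsets of `M_k ∖ K₀` are open in `Y`** (they are cut out of
the open `M_k`-part by the continuous `ψ`). [folklore] -/
theorem isOpen_image_jM {V : Set (EuclideanSpace ℝ (Fin 4))} (hV : IsOpen V) :
    IsOpen (P.jM '' {a | a ∈ modelBoundary k ∧ a ∉ range E.K₀ ∧ a ∈ V}) := by
  have heq : P.jM '' {a | a ∈ modelBoundary k ∧ a ∉ range E.K₀ ∧ a ∈ V} = E.mSet P.jM ∩ P.ψ ⁻¹' V := by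
    ext y
    constructor
    · rintro ⟨a, ⟨ha, ha', haV⟩, rfl⟩
      exact ⟨⟨a, ⟨ha, ha'⟩, rfl⟩, by show P.ψ (P.jM a) ∈ V; rwa [P.ψ_jM a ha ha']⟩
    · rintro ⟨⟨a, ⟨ha, ha'⟩, rfl⟩, hV'⟩
      refine ⟨a, ⟨ha, ha', ?_⟩, rfl⟩
      have : P.ψ (P.jM a) ∈ V := hV'
      rwa [P.ψ_jM a ha ha'] at this
  rw [heq]
  exact P.contMDiffOn_ψ.continuousOn.isOpen_inter_preimage P.isOpen_mSet hV

/-- The tube part of `Y` is open. [folklore] -/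
theorem isOpen_tubeSet : IsOpen (E.tubeSet P.jM) := by
  have heq : E.tubeSet P.jM = P.jM '' {a | a ∈ modelBoundary k ∧ a ∉ range E.K₀ ∧ a ∈
      {y : EuclideanSpace ℝ (Fin 4) | (∀ j, (1 : ℝ) / 2 < holeTerm k j y) ∧ levelFun k y ∈ Ioo (1 - E.δ) (1 + E.δ) ∧
        E.θ (1 - levelFun k y, y) ∈ range E.ν₀}} := by
    rw [tubeSet]
    congr 1
    ext a
    constructor
    · rintro ⟨ha, ha', h⟩; exact ⟨ha, ha', (E.mem_flowTube₀_iff_of_mem ha).2 h⟩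
    · rintro ⟨ha, ha', h⟩; exact ⟨ha, ha', (E.mem_flowTube₀_iff_of_mem ha).1 h⟩
  rw [heq]
  exact P.isOpen_image_jM E.isOpen_flowTube₀

/-- The radial part of `Y` is open. [folklore] -/
theorem isOpen_radSet : IsOpen (E.radSet P.jM) := by
  have heq : E.radSet P.jM = P.jM '' {a | a ∈ modelBoundary k ∧ a ∉ range E.K₀ ∧ a ∈ (E.closedTube)ᶜ} := by
    rw [radSet]
    congr 1
    ext a
    constructor
    · rintro ⟨ha, hat⟩; exact ⟨ha, fun h => hat (E.range_K₀_subset_closedTube h), hat⟩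
    · rintro ⟨ha, -, hat⟩; exact ⟨ha, hat⟩
  rw [heq]
  exact P.isOpen_image_jM E.isCompact_closedTube.isClosed.isOpen_compl

/-- `jB` is an open embedding. [folklore] -/
theorem isOpenEmbedding_jB : Topology.IsOpenEmbedding P.jB := ⟨P.jB_emb.isEmbedding, P.isOpen_range_jB⟩

/-- The inverse of `jB` is smooth on its range. [folklore] -/
theorem contMDiffOn_invFun_jB :
    ContMDiffOn (𝓡 3) (𝓘(ℝ, EuclideanSpace ℝ (Fin 2)).prod (𝓡 1)) ∞ (Function.invFun P.jB) (range P.jB) := by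
  have h := contMDiffOn_symm_of_isSmoothEmbedding P.jB_emb P.isOpenEmbedding_jB
  refine h.congr ?_
  rintro _ ⟨b, rfl⟩
  rw [Function.leftInverse_invFun P.injective_jB b]
  exact (P.isOpenEmbedding_jB.toOpenPartialHomeomorph_left_inv (x := b)).symm

/-- `invB : Y → ℝ² × 𝕊¹` is smooth on `range jB`. [folklore] -/
theorem contMDiffOn_invB : ContMDiffOn (𝓡 3) (𝓘(ℝ, EuclideanSpace ℝ (Fin 2)).prod (𝓡 1)) ∞ (TubeNbhd.invB P.jB) (range P.jB) :=
  contMDiff_subtype_val.comp_contMDiffOn P.contMDiffOn_invFun_jB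

/-- Tube coordinates `ι₀ ∘ ψ` are smooth on the tube part of `Y`. [folklore] -/
theorem contMDiffOn_coords : ContMDiffOn (𝓡 3) ((𝓡 1).prod 𝓘(ℝ, EuclideanSpace ℝ (Fin 2))) ∞ (fun y => E.ι₀ (P.ψ y)) (E.tubeSet P.jM) := by
  refine E.contMDiffOn_ι₀.comp (P.contMDiffOn_ψ.mono (E.tubeSet_subset_mSet P.jM)) ?_
  rintro _ ⟨a, ⟨ha, ha', hat⟩, rfl⟩
  show P.ψ (P.jM a) ∈ {y : EuclideanSpace ℝ (Fin 4) | (∀ j, (1 : ℝ) / 2 < holeTerm k j y) ∧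
    levelFun k y ∈ Ioo (1 - E.δ) (1 + E.δ) ∧ E.θ (1 - levelFun k y, y) ∈ range E.ν₀}
  rw [P.ψ_jM a ha ha']
  exact (E.mem_flowTube₀_iff_of_mem ha).2 hat

/-- On the tube part the collar is the tube formula. [folklore] -/
theorem collar_eq_of_mem_tubeSet {p : Y × ℝ} (hp : p.1 ∈ E.tubeSet P.jM) :
    E.collar P.jM P.jB P.ψ p = E.incl (E.fTube (E.ι₀ (P.ψ p.1), p.2)) := by
  obtain ⟨y, σ⟩ := p
  obtain ⟨a, ⟨ha, ha', haν⟩, rfl⟩ := hp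
  simp only
  rw [P.ψ_jM a ha ha', ← cTube_eq_fTube]
  by_cases hc : a ∈ E.closedTube
  · exact P.collar_of_mem_closedTube ha ha' hc σ
  · rw [P.collar_of_not_mem_closedTube ha hc]
    obtain ⟨⟨u, w⟩, hq⟩ := haν
    have hw : 2 ≤ ‖w‖ := by
      by_contra h
      exact hc (hq ▸ (E.mem_closedTube_iff).2 (not_le.1 h).le)
    rw [← hq]
    exact E.cRad_eq_cTube u hw σ

/-- Outside the closed tube the collar is the radial formula. [folklore] -/
theorem collar_eq_of_mem_radSet {p : Y × ℝ} (hp : p.1 ∈ E.radSet P.jM) :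
    E.collar P.jM P.jB P.ψ p = E.incl (E.fRad (P.ψ p.1, p.2)) := by
  obtain ⟨y, σ⟩ := p
  obtain ⟨a, ⟨ha, hat⟩, rfl⟩ := hp
  simp only
  rw [P.ψ_jM a ha (fun h => hat (E.range_K₀_subset_closedTube h)), ← cRad_eq_fRad]
  exact P.collar_of_not_mem_closedTube ha hat σ

/-- The flat region of `Y × ℝ` is open. [folklore] -/
theorem isOpen_flatSetY : IsOpen (TubeNbhd.flatSetY P.jB) := by
  have ho : IsOpen (range P.jB ×ˢ (univ : Set ℝ)) := P.isOpen_range_jB.prod isOpen_univ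
  have hc : ContinuousOn (fun p : Y × ℝ => ‖(TubeNbhd.invB P.jB p.1).1‖ * Real.exp (TraceCollar.ψinv (Real.exp (-p.2))))
      (range P.jB ×ˢ (univ : Set ℝ)) := by
    refine ContinuousOn.mul ?_ ?_
    · refine (continuous_norm.comp continuous_fst).comp_continuousOn ?_
      exact P.contMDiffOn_invB.continuousOn.comp continuous_fst.continuousOn fun p hp => hp.1
    · refine Continuous.continuousOn ?_
      refine Real.continuous_exp.comp ?_
      have h1 : Continuous fun p : Y × ℝ => Real.exp (-p.2) := Real.continuous_exp.comp (continuous_neg.comp continuous_snd)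
      exact TraceCollar.contDiffOn_ψinv.continuousOn.comp_continuous h1 fun p => Real.exp_pos _
  exact hc.isOpen_inter_preimage ho isOpen_Iio

/-- On the flat region the collar is the flat formula. [folklore] -/
theorem collar_eq_of_mem_flatSetY {p : Y × ℝ} (hp : p ∈ TubeNbhd.flatSetY P.jB) :
    E.collar P.jM P.jB P.ψ p = E.trGlueData.inr (TubeNbhd.fF (TubeNbhd.invB P.jB p.1, p.2)) := by
  obtain ⟨y, σ⟩ := p
  obtain ⟨⟨hy, -⟩, hlt⟩ := hp
  obtain ⟨⟨⟨pv, v⟩, hb⟩, rfl⟩ := hy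
  simp only [mem_setOf_eq] at hlt
  rw [P.invB_apply] at hlt ⊢
  simp only at hlt ⊢
  rw [← cFlat_eq_fF]
  by_cases hpv : pv = 0
  · subst hpv
    exact P.collar_of_core v hb σ
  · have hlt1 : ‖pv‖ < 1 := (mem_solidTorus_iff (pv, v)).1 hb
    have hpos : 0 < ‖pv‖ := norm_pos_iff.2 hpv
    have hya := P.jB_eq_jM ⟨(pv, v), hb⟩ hpv
    simp only at hya
    have hmem : E.ν₀ (radialProjection (spherePt 1) pv, ‖pv‖ • (v : EuclideanSpace ℝ (Fin 2))) ∈ E.closedTube := by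
      rw [mem_closedTube_iff, norm_smul_coe_sphere hpos.le]; linarith
    rw [hya, P.collar_of_mem_closedTube (E.ν₀_mem _) (E.ν₀_smul_not_mem_range hpos.ne' _ _) hmem]
    exact E.cTube_eq_cFlat hpv v σ hlt.le

/-- Points of `Y × ℝ` over the core circle of the surgery torus lie in the flat region. [folklore] -/
theorem mem_flatSetY_of_not_mem {p : Y × ℝ} (hp : p.1 ∉ E.mSet P.jM) : p ∈ TubeNbhd.flatSetY P.jB := by
  obtain ⟨v, h, hy⟩ := P.eq_jB_zero_of_not_mem hp
  refine ⟨⟨⟨_, hy⟩, mem_univ _⟩, ?_⟩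
  show ‖(TubeNbhd.invB P.jB p.1).1‖ * Real.exp (TraceCollar.ψinv (Real.exp (-p.2))) < 1
  rw [← hy, P.invB_apply]
  simp

/-- Every point of `Y` is in the tube part, in the radial part, or off the `M_k`-part. [folklore] -/
theorem mem_tubeSet_or (y : Y) : y ∈ E.tubeSet P.jM ∨ y ∈ E.radSet P.jM ∨ y ∉ E.mSet P.jM := by
  by_cases hy : y ∈ E.mSet P.jM
  · obtain ⟨a, ⟨ha, ha'⟩, rfl⟩ := hy
    by_cases hat : a ∈ range E.ν₀
    · exact Or.inl ⟨a, ⟨ha, ha', hat⟩, rfl⟩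
    · exact Or.inr (Or.inl ⟨a, ⟨ha, fun h => hat (image_subset_range _ _ h)⟩, rfl⟩)
  · exact Or.inr (Or.inr hy)

/-- **The collar is smooth.** [folklore] -/
theorem contMDiff_collar : ContMDiff ((𝓡 3).prod 𝓘(ℝ, ℝ)) (𝓡 4) ∞ (E.collar P.jM P.jB P.ψ) := by
  intro p
  rcases P.mem_tubeSet_or p.1 with hp | hp | hp
  · -- tube part: `collar = incl ∘ fTube ∘ (ι₀ ∘ ψ × id)`
    have hopen : IsOpen ((E.tubeSet P.jM) ×ˢ (univ : Set ℝ)) := P.isOpen_tubeSet.prod isOpen_univ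
    have hev : E.collar P.jM P.jB P.ψ =ᶠ[𝓝 p] fun p => E.incl (E.fTube (E.ι₀ (P.ψ p.1), p.2)) := by
      filter_upwards [hopen.mem_nhds ⟨hp, mem_univ _⟩] with p' hp'
      exact P.collar_eq_of_mem_tubeSet hp'.1
    refine ContMDiffAt.congr_of_eventuallyEq ?_ hev
    have hco' : ContMDiffAt ((𝓡 3).prod 𝓘(ℝ, ℝ)) (((𝓡 1).prod 𝓘(ℝ, EuclideanSpace ℝ (Fin 2))).prod 𝓘(ℝ, ℝ)) ∞
        (fun p : Y × ℝ => (E.ι₀ (P.ψ p.1), p.2)) p :=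
      ((P.contMDiffOn_coords.contMDiffAt (P.isOpen_tubeSet.mem_nhds hp)).comp p contMDiffAt_fst).prodMk contMDiffAt_snd
    -- the fibre coordinate is nonzero
    obtain ⟨a, ⟨ha, ha', ⟨q, hq⟩⟩, hpa⟩ := hp
    have hco : E.ι₀ (P.ψ p.1) = q := by rw [← hpa, P.ψ_jM a ha ha', ← hq, E.ι₀_ν₀]
    have hw : (E.ι₀ (P.ψ p.1)).2 ≠ 0 := by
      rw [hco]
      intro h0
      apply ha'
      rw [← hq, show q = (q.1, q.2) from rfl, h0]
      exact E.ν₀_mem_range_iff.2 rfl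
    have hfT : ContMDiffAt (((𝓡 1).prod 𝓘(ℝ, EuclideanSpace ℝ (Fin 2))).prod 𝓘(ℝ, ℝ)) 𝓘(ℝ, EuclideanSpace ℝ (Fin 4)) ∞ E.fTube
        (E.ι₀ (P.ψ p.1), p.2) :=
      E.contMDiffOn_fTube.contMDiffAt ((isOpen_ne.preimage (continuous_snd.comp continuous_fst)).mem_nhds hw)
    have hincl : ContMDiffAt (𝓡 4) (𝓡 4) ∞ E.incl (E.fTube (E.ι₀ (P.ψ p.1), p.2)) :=
      E.contMDiffOn_incl.contMDiffAt (E.isOpen_hbNbhd.mem_nhds (E.fTube_mem_hbNbhd hw))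
    exact ContMDiffAt.comp (g := E.incl) (f := fun p : Y × ℝ => E.fTube (E.ι₀ (P.ψ p.1), p.2)) p hincl
      (ContMDiffAt.comp (g := E.fTube) (f := fun p : Y × ℝ => (E.ι₀ (P.ψ p.1), p.2)) p hfT hco')
  · -- radial part: `collar = incl ∘ fRad ∘ (ψ × id)`
    have hopen : IsOpen ((E.radSet P.jM) ×ˢ (univ : Set ℝ)) := P.isOpen_radSet.prod isOpen_univ
    have hev : E.collar P.jM P.jB P.ψ =ᶠ[𝓝 p] fun p => E.incl (E.fRad (P.ψ p.1, p.2)) := by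
      filter_upwards [hopen.mem_nhds ⟨hp, mem_univ _⟩] with p' hp'
      exact P.collar_eq_of_mem_radSet hp'.1
    refine ContMDiffAt.congr_of_eventuallyEq ?_ hev
    obtain ⟨a, ⟨ha, hat⟩, hpa⟩ := hp
    have ha' : a ∉ range E.K₀ := fun h => hat (E.range_K₀_subset_closedTube h)
    have hψa : P.ψ p.1 = a := by rw [← hpa, P.ψ_jM a ha ha']
    have hco : ContMDiffAt ((𝓡 3).prod 𝓘(ℝ, ℝ)) 𝓘(ℝ, EuclideanSpace ℝ (Fin 4) × ℝ) ∞
        (fun p : Y × ℝ => (P.ψ p.1, p.2)) p :=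
      ((P.contMDiffOn_ψ.contMDiffAt (P.isOpen_mSet.mem_nhds ⟨a, ⟨ha, ha'⟩, hpa⟩)).comp p contMDiffAt_fst).prodMk_space contMDiffAt_snd
    have hfR : ContMDiffAt 𝓘(ℝ, EuclideanSpace ℝ (Fin 4) × ℝ) 𝓘(ℝ, EuclideanSpace ℝ (Fin 4)) ∞ E.fRad (P.ψ p.1, p.2) :=
      E.contDiff_fRad.contMDiff.contMDiffAt
    have hincl : ContMDiffAt (𝓡 4) (𝓡 4) ∞ E.incl (E.fRad (P.ψ p.1, p.2)) :=
      E.contMDiffOn_incl.contMDiffAt (E.isOpen_hbNbhd.mem_nhds (by rw [hψa]; exact E.fRad_mem_hbNbhd ha _))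
    exact ContMDiffAt.comp (g := E.incl) (f := fun p : Y × ℝ => E.fRad (P.ψ p.1, p.2)) p hincl
      (ContMDiffAt.comp (g := E.fRad) (f := fun p : Y × ℝ => (P.ψ p.1, p.2)) p hfR hco)
  · -- flat region: `collar = inr ∘ fF ∘ (invB × id)`
    have hmem : p ∈ TubeNbhd.flatSetY P.jB := P.mem_flatSetY_of_not_mem hp
    have hev : E.collar P.jM P.jB P.ψ =ᶠ[𝓝 p] fun p => E.trGlueData.inr (TubeNbhd.fF (TubeNbhd.invB P.jB p.1, p.2)) := by
      filter_upwards [P.isOpen_flatSetY.mem_nhds hmem] with p' hp'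
      exact P.collar_eq_of_mem_flatSetY hp'
    refine ContMDiffAt.congr_of_eventuallyEq ?_ hev
    have hco : ContMDiffAt ((𝓡 3).prod 𝓘(ℝ, ℝ)) ((𝓘(ℝ, EuclideanSpace ℝ (Fin 2)).prod (𝓡 1)).prod 𝓘(ℝ, ℝ)) ∞
        (fun p : Y × ℝ => (TubeNbhd.invB P.jB p.1, p.2)) p :=
      ((P.contMDiffOn_invB.contMDiffAt (P.isOpen_range_jB.mem_nhds hmem.1.1)).comp p contMDiffAt_fst).prodMk contMDiffAt_snd
    exact E.trGlueData.contMDiff_inr.contMDiffAt.comp p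
      (ContMDiffAt.comp (g := TubeNbhd.fF) (f := fun p : Y × ℝ => (TubeNbhd.invB P.jB p.1, p.2)) p
        TubeNbhd.contMDiff_fF.contMDiffAt hco)

end SmoothPresentation

end EndDatum

end FriendsTk

/-- **Helper `helper_friendsCarrier_Tk_endSmoothCollar`** (registered on the crux item; end collar part 5
of stub `helper_friendsCarrier_Tk`): under the hypotheses of `helper_friendsCarrier_Tk` (a tube `ν` of the
model knot and a smooth presentation of `Y` as `M_k` surgered along it), the end collar `c : Y × ℝ → T` of
the relative open trace of `D_k` is a `C^∞` injective map (Kirby 1989, Ch. I §5). [cite: Kirby1989, Ch. I §5] -/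
theorem helper_friendsCarrier_Tk_endSmoothCollar : ∀ (k : ℕ) (K₀ : (sphere (0 : EuclideanSpace ℝ (Fin 2)) 1) → EuclideanSpace ℝ (Fin 4)), IsModelKnot k K₀ → ∀ (Y : Type) [TopologicalSpace Y] [T2Space Y] [SecondCountableTopology Y] [ChartedSpace (EuclideanSpace ℝ (Fin 3)) Y] [IsManifold (𝓡 3) ∞ Y] (jB : solidTorus → Y) (μ₀ : C((sphere (0 : EuclideanSpace ℝ (Fin 2)) 1), Y)) (νK : (sphere (0 : EuclideanSpace ℝ (Fin 2)) 1) × EuclideanSpace ℝ (Fin 2) → EuclideanSpace ℝ (Fin 4)) (jM : EuclideanSpace ℝ (Fin 4) → Y) (W : Set (EuclideanSpace ℝ (Fin 4))) (ψ : Y → EuclideanSpace ℝ (Fin 4)), (Manifold.IsSmoothEmbedding (𝓘(ℝ, EuclideanSpace ℝ (Fin 2)).prod (𝓡 1)) (𝓡 3) ∞ jB ∧ IsOpen (range jB) ∧ ContMDiff ((𝓡 1).prod 𝓘(ℝ, EuclideanSpace ℝ (Fin 2))) 𝓘(ℝ, EuclideanSpace ℝ (Fin 4)) ∞ νK ∧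 Injective νK ∧ (∀ p, Injective (mfderiv ((𝓡 1).prod 𝓘(ℝ, EuclideanSpace ℝ (Fin 2))) 𝓘(ℝ, EuclideanSpace ℝ (Fin 4)) νK p)) ∧ (∀ p, νK p ∈ modelBoundary k) ∧ (∀ u : (sphere (0 : EuclideanSpace ℝ (Fin 2)) 1), νK (u, 0) = K₀ u) ∧ IsOpen W ∧ (∀ x ∈ modelBoundary k, x ∉ range K₀ → x ∈ W) ∧ ContMDiffOn 𝓘(ℝ, EuclideanSpace ℝ (Fin 4)) (𝓡 3) ∞ jM W ∧ IsOpen (jM '' {x : EuclideanSpace ℝ (Fin 4) | x ∈ modelBoundary k ∧ x ∉ range K₀}) ∧ ContMDiffOn (𝓡 3) 𝓘(ℝ, EuclideanSpace ℝ (Fin 4)) ∞ ψ (jM '' {x : EuclideanSpace ℝ (Fin 4) | x ∈ modelBoundary k ∧ x ∉ range K₀}) ∧ (∀ x ∈ modelBoundary k, x ∉ range K₀ → ψ (jM x) = x) ∧ jM '' {x : EuclideanSpace ℝ (Fin 4) | x ∈ modelBoundary k ∧ x ∉ range K₀} ∪ range jB = univ ∧ (∀ x ∈ modelBoundary k, x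 ∉ range K₀ → ∀ b : solidTorus, jM x = jB b ↔ ∃ (u : (sphere (0 : EuclideanSpace ℝ (Fin 2)) 1)) (t : ℝ), t ∈ Ioo (0 : ℝ) 1 ∧ b.1.1 = t • (u : EuclideanSpace ℝ (Fin 2)) ∧ x = νK (u, t • (b.1.2 : EuclideanSpace ℝ (Fin 2))))) → ∃ (X : Type) (_ : TopologicalSpace X) (_ : T2Space X) (_ : ChartedSpace (EuclideanSpace ℝ (Fin 4)) X) (_ : IsManifold (𝓡 4) ∞ X) (c : Y × ℝ → X), ContMDiff ((𝓡 3).prod 𝓘(ℝ, ℝ)) (𝓡 4) ∞ c ∧ Injective c := by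
  intro k K₀ _ Y _ _ _ _ _ jB μ₀ νK jM W ψ ⟨h1, h2, h3, h4, h5, h6, h7, h8, h9, h10, h11, h12, h13, h14, h15⟩
  let E : FriendsTk.EndDatum k := FriendsTk.EndDatum.endDatumOf h3 h4 h5 h6 h7
  let P : E.SmoothPresentation Y := FriendsTk.EndDatum.smoothPresentationOf h3 h4 h5 h6 h7 h1 h2 h8 h9 h10 h11 h12 h13 h14 h15
  exact ⟨E.Trace, inferInstance, inferInstance, inferInstance, inferInstance, E.collar P.jM P.jB P.ψ,
    P.contMDiff_collar, P.collar_injective⟩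

end Summit.SmoothPoincare4.SmoothPoincare4.Theorems.DcrGap.MkFriends

end
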